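import Literature.AlgebraicGeometry.Smoothening.NeronDefect
import HarnessLib

/-!
# Néron's measure of a point given as an algebra homomorphism

Topic: `Literature/AlgebraicGeometry/Smoothening` (Bosch–Lütkebohmert–Raynaud, *Néron Models*,
§3.3: `δ(a)` for `a ∈ X(R')`). `NeronDefect.neronDefect R A R'` takes the point as an instance
`[Algebra A R']`; in the smoothening process (§3.4) points of varying charts with values in
varying discrete valuation rings are moved around, so we also provide the version taking the
point as an `R`-algebra homomorphism `a : A →ₐ[R] R'` (`neronDefectOfHom`), its invariance under
`R`-algebra isomorphisms of the source (`neronDefectOfHom_comp_algEquiv`) and its locality along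
localisations (`neronDefectOfHom_comp_of_isLocalization`). [folklore]; no named facts (D-0026).

## References

* S. Bosch, W. Lütkebohmert, M. Raynaud, *Néron Models*, Springer 1990, §3.3.
  [BLRNeronModels1990] (Not held; number only.)
-/

noncomputable section

namespace Literature.AlgebraicGeometry.Smoothening

universe u

variable (R : Type u) [CommRing R] {A : Type u} [CommRing A] [Algebra R A] {A' : Type u}
  [CommRing A'] [Algebra R A'] (S : Type u) [CommRing S] [Algebra R S]

/-- **`δ(a)` for a point `a : A → S` given as an `R`-algebra homomorphism.** [folklore] -/
def neronDefectOfHom (a : A →ₐ[R] S) : ℕ∞ :=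
  @neronDefect R _ A _ _ S _ a.toRingHom.toAlgebra

/-- `neronDefectOfHom` is `neronDefect` for the algebra structure defined by the point.
[folklore] -/
theorem neronDefectOfHom_eq (a : A →ₐ[R] S) :
    letI := a.toRingHom.toAlgebra
    neronDefectOfHom R S a = neronDefect R A S := rfl

/-- **Locality**: if `A'` is a localisation of `A` then `δ(a' ∘ (A → A')) = δ(a')` — Néron's
measure of a point only depends on the local ring at the point. [folklore] -/
theorem neronDefectOfHom_comp_of_isLocalization [Algebra A A'] [IsScalarTower R A A']
    (M : Submonoid A) [IsLocalization M A'] (a' : A' →ₐ[R] S) :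
    neronDefectOfHom R S (a'.comp (IsScalarTower.toAlgHom R A A')) = neronDefectOfHom R S a' := by
  letI := a'.toRingHom.toAlgebra
  letI := (a'.comp (IsScalarTower.toAlgHom R A A')).toRingHom.toAlgebra
  haveI : IsScalarTower A A' S := IsScalarTower.of_algebraMap_eq fun x => rfl
  exact neronDefect_eq_of_isLocalization R A A' M S

/-- **Invariance under isomorphisms of the source**: `δ(a' ∘ e) = δ(a')` for an `R`-algebra
isomorphism `e : A ≃ A'`. [folklore] -/
theorem neronDefectOfHom_comp_algEquiv (e : A ≃ₐ[R] A') (a' : A' →ₐ[R] S) :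
    neronDefectOfHom R S (a'.comp (e : A →ₐ[R] A')) = neronDefectOfHom R S a' := by
  letI : Algebra A A' := (e : A →+* A').toAlgebra
  haveI : IsScalarTower R A A' := IsScalarTower.of_algebraMap_eq fun r => (e.commutes r).symm
  let e' : A ≃ₐ[A] A' := AlgEquiv.ofRingEquiv (f := e.toRingEquiv) fun _ => rfl
  haveI : IsLocalization (IsUnit.submonoid A) A' :=
    IsLocalization.isLocalization_of_algEquiv (IsUnit.submonoid A) e'
  have h := neronDefectOfHom_comp_of_isLocalization R S (IsUnit.submonoid A) a'
  have he : (e : A →ₐ[R] A') = IsScalarTower.toAlgHom R A A' := AlgHom.ext fun _ => rfl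
  rw [he]
  exact h

end Literature.AlgebraicGeometry.Smoothening

end
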